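import Summits.RiemannHypothesis.RiemannHypothesis.Theses.NbTruncationBarrier
import Summits.RiemannHypothesis.RiemannHypothesis.Theorems.Splittings.NbTruncationD
import HarnessLib

/-!
# Route NbTruncationBarrier (L6 «NB TRUNCATION BARRIER B21 + T45») — crux `SmallSections` (RH-FREE)

Item stmt-RiemannHypothesis-21763 = `FIN_1 ∧ FIN_2 ∧ ¬FIN_0` is the conjunction of three tree theorems of
lane (xv-V) (Theorems/Splittings/NbTruncationD.lean §4):
`Splittings.NbTruncation.truncFin_one` (`ζ_1 = 1`, `A = 1`), `Splittings.NbTruncation.truncFin_two`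
(`ζ_2 = 1 + 2^{-s}`, dyadic alternating mollifier, distance `2π·2^{-K}`), `Splittings.NbTruncation.not_truncFin_zero`
(`ζ_0 = 0`, every distance `2π`). Standard axioms. One-line closer, cited by name.
RH-free; no summit is proved by this; nothing here bears on the truth of RH.
-/

-- D-0017: `Summit.RiemannHypothesis.RiemannHypothesis.…` duplicates the namespace BY DESIGN (single-problem summit).
set_option linter.dupNamespace false

namespace Summit.RiemannHypothesis.RiemannHypothesis.Theorems.NbTruncationBarrier

/-- **Crux `SmallSections` (item stmt-RiemannHypothesis-21763) holds**: `FIN_1`, `FIN_2` and `¬FIN_0`, by the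
tree theorems `truncFin_one`, `truncFin_two`, `not_truncFin_zero` of `Splittings.NbTruncation`. RH-free,
standard axioms. -/
theorem smallSections_proof :
    Summit.RiemannHypothesis.RiemannHypothesis.Theses.NbTruncationBarrier.SmallSections :=
  ⟨Splittings.NbTruncation.truncFin_one, Splittings.NbTruncation.truncFin_two,
    Splittings.NbTruncation.not_truncFin_zero⟩

end Summit.RiemannHypothesis.RiemannHypothesis.Theorems.NbTruncationBarrier
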